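import Summits.HubbardSuperconductivity.HubbardSuperconductivity.Theorems.ThermalWedgeTwSeededEnsembleEquivalenceROptimiserFloor
import Summits.HubbardSuperconductivity.HubbardSuperconductivity.Theorems.ThermalWedgeTwSeededEnsembleEquivalenceRSourcedPressureLimit
import Summits.HubbardSuperconductivity.HubbardSuperconductivity.Theorems.ThermalWedgeTwSeededEnsembleEquivalenceRSharpSectorEntropy
import Summits.HubbardSuperconductivity.HubbardSuperconductivity.Theorems.ThermalWedgeTwApproximatingHamiltonian
import Summits.HubbardSuperconductivity.HubbardSuperconductivity.Theorems.ThermalWedgeTwSeededEnsembleEquivalenceRPbSectorSelection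
import Summits.HubbardSuperconductivity.HubbardSuperconductivity.Theorems.ThermalWedgeTwSeededEnsembleEquivalenceRSectorWeightLipschitz
import Summits.HubbardSuperconductivity.HubbardSuperconductivity.Theorems.ThermalWedgeTwSeededEnsembleEquivalenceRBlockProduct
import Summits.HubbardSuperconductivity.HubbardSuperconductivity.Theorems.ThermalWedgeTwSeededEnsembleEquivalenceRLogPartitionCalculus
import Summits.HubbardSuperconductivity.HubbardSuperconductivity.Theorems.ThermalWedgeTwSeededEnsembleEquivalenceRColdSlice
import Literature.MathematicalPhysics.QuantumLattice.DuhamelTwoPoint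
import Literature.MathematicalPhysics.QuantumLattice.DuhamelEqualTimeBounds
import Literature.MathematicalPhysics.QuantumLattice.GibbsLinearResponse

/-!
# Crux `TwSeededEnsembleEquivalenceR` (stmt-HubbardSuperconductivity-15581), line `cold-floor-collapse` (slug `Sketch`),
# skeleton v8 (block two-phase pinning) — registered stub `stub_coldSlicePackaging`

Support file (`--supports stmt-HubbardSuperconductivity-15581`; sorry-free; no definition).
S7a + NoSplit + S7d + sharp normal form ⟹ cold slice.
-/

set_option linter.dupNamespace false

namespace Summit.HubbardSuperconductivity.HubbardSuperconductivity.Theorems.TwSeededEnsembleEquivalenceR.ColdFloorLine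

open Matrix Filter Topology Finset Literature.MathematicalPhysics.QuantumLattice
open Literature.Barriers.HubbardSuperconductivity Literature.Probability.LatticeModels
open scoped ComplexOrder Matrix.Norms.L2Operator

noncomputable section

/-- Real-arithmetic core of the packaging: from the sharp normal form
`β(E − μN) + log Z ≤ log C + D`, the entropy count `log C ≤ L² log 4` and the two-phase defect bound
`D ≤ β ε L²`, the cold-slice inequality `E/L² + log Z/(βL²) − μN/L² ≤ log 4/β + ε` (divide by `βL² > 0`). -/
private theorem packaging_arith {β L2 E Z μ C D ε : ℝ} {n : ℕ} (hβ : 0 < β) (hL2 : 0 < L2)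
    (hNF : β * (E - μ * ((2 * n : ℕ) : ℝ)) + Z ≤ C + D) (hC : C ≤ L2 * Real.log 4)
    (hD : D ≤ β * ε * L2) :
    E / L2 + Z / (β * L2) - μ * (2 * (n : ℝ)) / L2 ≤ Real.log 4 / β + ε := by
  have hβL : 0 < β * L2 := mul_pos hβ hL2
  have hN : ((2 * n : ℕ) : ℝ) = 2 * (n : ℝ) := by push_cast; ring
  rw [hN] at hNF
  have hlhs : E / L2 + Z / (β * L2) - μ * (2 * (n : ℝ)) / L2 =
      (β * (E - μ * (2 * (n : ℝ))) + Z) / (β * L2) := by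
    field_simp
    ring
  have hrhs : Real.log 4 / β + ε = (L2 * Real.log 4 + β * ε * L2) / (β * L2) := by
    rw [eq_div_iff hβL.ne']
    field_simp
  rw [hlhs, hrhs, div_le_div_iff_of_pos_right hβL]
  linarith

/-- (registered stub `stub_coldSlicePackaging` of skeleton v8.1; statement verbatim — see Lines/Sketch.lean for the docstring) -/
theorem stub_coldSlicePackaging :
    (∀ δ ∈ Set.Icc (1/10 : ℝ) (2/5 : ℝ), ∀ (a U g : ℝ), 0 < a → 0 < U → U ≤ 1 / 10000000 →
      (20000 : ℝ) ≤ Real.exp (a / U) → 0 < g → g ≤ 1 / 10 → ∀ q : ℝ → ℝ → ℝ,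
        (∀ μ ∈ Set.Icc (-(399 / 100) : ℝ) (-(1 / 400000) : ℝ), ∀ h ∈ Set.Icc (-(13 * g + 1)) (13 * g + 1), ∀ κ : ℝ, 0 < κ →
            ∃ L₀ : ℕ, ∀ (L : ℕ) [NeZero L], L₀ ≤ L →
              |Real.log (Matrix.partitionFn (Real.exp (a / U)) (dWaveSourceTorus L U μ h)).re /
                  (Real.exp (a / U) * (L : ℝ) ^ 2) - q μ h| ≤ κ) →
        ∃ μs ∈ Set.Icc (-(99 / 25) : ℝ) (-(1 / 200000) : ℝ), ∀ μ' ∈ Set.Icc (-(399 / 100) : ℝ) (-(1 / 400000) : ℝ),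
          sSup ((fun h' : ℝ => q μs h' - h' ^ 2 / g) '' Set.Icc (-(13 * g + 1)) (13 * g + 1)) + (1 - δ) * (μ' - μs) ≤ sSup ((fun h' : ℝ => q μ' h' - h' ^ 2 / g) '' Set.Icc (-(13 * g + 1)) (13 * g + 1))) →
    (∀ (μ₁ μ₂ : ℝ), -4 < μ₁ → μ₁ < μ₂ → μ₂ < 0 → ∃ a K' U₀ : ℝ, 0 < a ∧ 0 < K' ∧ 0 < U₀ ∧
      ∀ U ∈ Set.Ioc (0 : ℝ) U₀, ∀ g ∈ Set.Icc (K' * U) (1 / 10), ∀ q : ℝ → ℝ → ℝ,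
        (∀ μ ∈ Set.Icc μ₁ μ₂, ∀ h ∈ Set.Icc (-(13 * g + 1)) (13 * g + 1), ∀ κ : ℝ, 0 < κ →
            ∃ L₀ : ℕ, ∀ (L : ℕ) [NeZero L], L₀ ≤ L →
              |Real.log (Matrix.partitionFn (Real.exp (a / U)) (dWaveSourceTorus L U μ h)).re /
                  (Real.exp (a / U) * (L : ℝ) ^ 2) - q μ h| ≤ κ) →
        ∀ μ ∈ Set.Ioo μ₁ μ₂, ∀ ν : ℝ,
          (∀ μ' ∈ Set.Icc μ₁ μ₂, sSup ((fun h' : ℝ => q μ h' - h' ^ 2 / g) '' Set.Icc (-(13 * g + 1)) (13 * g + 1)) + ν * (μ' - μ) ≤ sSup ((fun h' : ℝ => q μ' h' - h' ^ 2 / g) '' Set.Icc (-(13 * g + 1)) (13 * g + 1))) →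
          ∃ h₀ ∈ Set.Icc (-(13 * g + 1)) (13 * g + 1),
            q μ h₀ - h₀ ^ 2 / g = sSup ((fun h' : ℝ => q μ h' - h' ^ 2 / g) '' Set.Icc (-(13 * g + 1)) (13 * g + 1)) ∧
            ∀ μ' ∈ Set.Icc μ₁ μ₂, q μ h₀ + ν * (μ' - μ) ≤ q μ' h₀) →
    (∀ (β U g δ μ₁ μ₂ μs h₀ : ℝ), 0 < β → 0 ≤ U → 0 < g → δ ∈ Set.Icc (1/10 : ℝ) (2/5 : ℝ) → μ₁ < μs → μs < μ₂ →
      h₀ ∈ Set.Icc (-(13 * g + 1)) (13 * g + 1) → ∀ q : ℝ → ℝ → ℝ,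
      (∀ μ ∈ Set.Icc μ₁ μ₂, ∀ h ∈ Set.Icc (-(13 * g + 1)) (13 * g + 1), ∀ κ : ℝ, 0 < κ →
        ∃ L₀ : ℕ, ∀ (L : ℕ) [NeZero L], L₀ ≤ L →
          |Real.log (Matrix.partitionFn β (dWaveSourceTorus L U μ h)).re / (β * (L : ℝ) ^ 2) - q μ h| ≤ κ) →
      q μs h₀ - h₀ ^ 2 / g = sSup ((fun h' : ℝ => q μs h' - h' ^ 2 / g) '' Set.Icc (-(13 * g + 1)) (13 * g + 1)) →
      (∀ μ' ∈ Set.Icc μ₁ μ₂, q μs h₀ + (1 - δ) * (μ' - μs) ≤ q μ' h₀) →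
      ∀ ε : ℝ, 0 < ε → ∃ L₀ : ℕ, ∀ (L : ℕ) [NeZero L], L₀ ≤ L →
        Real.log ((Matrix.partitionFn β (hubbardTorusWith 2 L 1 U μs - ((g / (L : ℝ) ^ 2 : ℝ) : ℂ) • ((pairField dWaveFormFactor L)ᴴ * pairField dWaveFormFactor L))).re /
            (∑ s ∈ (Finset.univ.filter fun s : Finset (Orb (FermionTorus 2 L)) => s.card = (2 * ⌊(1 - δ) * (L : ℝ) ^ 2 / 2⌋₊)), (Matrix.gibbsWeight β (hubbardTorusWith 2 L 1 U μs - ((g / (L : ℝ) ^ 2 : ℝ) : ℂ) • ((pairField dWaveFormFactor L)ᴴ * pairField dWaveFormFactor L)) s s).re)) ≤ β * ε * (L : ℝ) ^ 2) →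
    ∀ δ ∈ Set.Icc (1/10 : ℝ) (2/5 : ℝ), ∃ μ₁ μ₂ : ℝ, -4 < μ₁ ∧ μ₁ ≤ μ₂ ∧ μ₂ < 0 ∧
        ∃ a K' U₀ : ℝ, 0 < a ∧ 0 < K' ∧ 0 < U₀ ∧ ∀ U ∈ Set.Ioc (0 : ℝ) U₀,
          ∀ g ∈ Set.Icc (K' * U) (1 / 10),
            ∃ μ ∈ Set.Icc μ₁ μ₂, ∀ ε : ℝ, 0 < ε → ∃ L₀ : ℕ, ∀ (L : ℕ) [NeZero L], L₀ ≤ L →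
              ((hubbardTorus 2 L 1 U - ((g / (L : ℝ) ^ 2 : ℝ) : ℂ) •
                ((pairField dWaveFormFactor L)ᴴ * pairField dWaveFormFactor L)).minEnergyOn
                  (szSector (Λ := FermionTorus 2 L) (2 * ⌊(1 - δ) * (L : ℝ) ^ 2 / 2⌋₊) 0) /
                    (L : ℝ) ^ 2) +
                (Real.log (Matrix.partitionFn (Real.exp (a / U)) (hubbardTorusWith 2 L 1 U μ -
                  ((g / (L : ℝ) ^ 2 : ℝ) : ℂ) •
                    ((pairField dWaveFormFactor L)ᴴ * pairField dWaveFormFactor L))).re /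
                      (Real.exp (a / U) * (L : ℝ) ^ 2)) -
                μ * ((2 * ⌊(1 - δ) * (L : ℝ) ^ 2 / 2⌋₊) : ℝ) / (L : ℝ) ^ 2 ≤
                  Real.log 4 / Real.exp (a / U) + ε := by
  intro hEdge hNoSplit hCore δ hδ
  -- fixed window `[μ₁, μ₂] := [−399/100, −1/400000]` and the NoSplit data on it
  obtain ⟨a, K', U₀, ha, hK', hU₀, hns⟩ :=
    hNoSplit (-(399 / 100)) (-(1 / 400000)) (by norm_num) (by norm_num) (by norm_num)
  have hlogB : 0 < Real.log 20000 := Real.log_pos (by norm_num)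
  set U₁ : ℝ := min U₀ (min (1 / 10000000) (a / Real.log 20000)) with hU₁def
  have hU₁pos : 0 < U₁ := lt_min hU₀ (lt_min (by norm_num) (div_pos ha hlogB))
  refine ⟨-(399 / 100), -(1 / 400000), by norm_num, by norm_num, by norm_num, a, K', U₁, ha, hK', hU₁pos,
    fun U hU g hg => ?_⟩
  have hUU₀ : U ∈ Set.Ioc (0 : ℝ) U₀ := ⟨hU.1, hU.2.trans (min_le_left _ _)⟩
  have hUsmall : U ≤ 1 / 10000000 := hU.2.trans ((min_le_right _ _).trans (min_le_left _ _))
  have hUa : U ≤ a / Real.log 20000 := hU.2.trans ((min_le_right _ _).trans (min_le_right _ _))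
  have hUpos : 0 < U := hU.1
  -- the inverse temperature `β := exp(a/U) ≥ 20000` (adapted from `…RColdEdgeGlue`)
  set β : ℝ := Real.exp (a / U) with hβdef
  have hβ : 0 < β := Real.exp_pos _
  have hβB : 20000 ≤ β := by
    have h1 : Real.log 20000 ≤ a / U := by
      rw [le_div_iff₀ hUpos]
      calc Real.log 20000 * U ≤ Real.log 20000 * (a / Real.log 20000) :=
            mul_le_mul_of_nonneg_left hUa hlogB.le
        _ = a := by field_simp
    calc (20000 : ℝ) = Real.exp (Real.log 20000) := (Real.exp_log (by norm_num)).symm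
      _ ≤ Real.exp (a / U) := Real.exp_le_exp.2 h1
  have hg0 : 0 < g := lt_of_lt_of_le (mul_pos hK' hUpos) hg.1
  -- the sourced limit (S3), chosen globally in `(μ, h)`
  choose qf hqf using fun μ h => stub_sourcedPressureLimit β U μ h hβ
  -- (EDGE + sweep): the point `μs` with `B`-subgradient `1 − δ` on the window
  obtain ⟨μs, hμs, hsub⟩ :=
    hEdge δ hδ a U g ha hUpos hUsmall hβB hg0 hg.2 qf (fun μ _ h _ κ hκ => hqf μ h κ hκ)
  have hμs1 : (-(399 / 100) : ℝ) < μs := by linarith [hμs.1]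
  have hμs2 : μs < (-(1 / 400000) : ℝ) := by linarith [hμs.2]
  -- (NoSplit): a common maximiser `h₀` carrying the subgradient
  obtain ⟨h₀, hh₀, hmax, hsubq⟩ :=
    hns U hUU₀ g hg qf (fun μ _ h _ κ hκ => hqf μ h κ hκ) μs ⟨hμs1, hμs2⟩ (1 - δ) hsub
  -- (two-phase core): the defect bound `log (Re Z / W(N_L)) ≤ β ε L²`
  have hcore := hCore β U g δ (-(399 / 100)) (-(1 / 400000)) μs h₀ hβ hUpos.le hg0 hδ hμs1 hμs2 hh₀ qf
    (fun μ _ h _ κ hκ => hqf μ h κ hκ) hmax hsubq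
  refine ⟨μs, ⟨hμs1.le, hμs2.le⟩, fun ε hε => ?_⟩
  obtain ⟨L₀, hL₀⟩ := hcore ε hε
  refine ⟨max 1 L₀, fun L _ hL => ?_⟩
  have hdef := hL₀ L (le_of_max_le_right hL)
  -- the sharp normal form at `n := ⌊(1−δ)L²/2⌋` and the sector entropy count
  have hLpos : (0 : ℝ) < (L : ℝ) := by exact_mod_cast Nat.pos_of_ne_zero (NeZero.ne L)
  have hL2 : (0 : ℝ) < (L : ℝ) ^ 2 := by positivity
  have hnL : ⌊(1 - δ) * (L : ℝ) ^ 2 / 2⌋₊ ≤ L ^ 2 := by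
    have hfl : (⌊(1 - δ) * (L : ℝ) ^ 2 / 2⌋₊ : ℝ) ≤ (1 - δ) * (L : ℝ) ^ 2 / 2 :=
      Nat.floor_le (by have : 0 ≤ 1 - δ := by linarith [hδ.2]
                       positivity)
    have h1 : (⌊(1 - δ) * (L : ℝ) ^ 2 / 2⌋₊ : ℝ) ≤ ((L ^ 2 : ℕ) : ℝ) := by
      push_cast
      nlinarith [hδ.1]
    exact_mod_cast h1
  have hNF := HotWindow.hw_sharpDefectNormalForm L U g β μs ⌊(1 - δ) * (L : ℝ) ^ 2 / 2⌋₊ hβ hnL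
  have hC : Real.log ((2 * L ^ 2).choose (2 * ⌊(1 - δ) * (L : ℝ) ^ 2 / 2⌋₊)) ≤ (L : ℝ) ^ 2 * Real.log 4 := by
    have h := HotWindow.log_choose_sector_le L (δ := δ) (by linarith [hδ.1]) (by linarith [hδ.2])
    have hb : Real.binEntropy ((1 - δ) / 2) ≤ Real.log 2 := Real.binEntropy_le_log_two
    have h4 : Real.log 4 = 2 * Real.log 2 := by
      rw [show (4 : ℝ) = 2 ^ 2 by norm_num, Real.log_pow]; norm_num
    rw [h4]
    nlinarith [hL2]
  exact packaging_arith hβ hL2 hNF hC hdef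

end

end Summit.HubbardSuperconductivity.HubbardSuperconductivity.Theorems.TwSeededEnsembleEquivalenceR.ColdFloorLine
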